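import Summits.CriticalPhenomena.PercolationContinuityZ3.Theorems.SahiMasterFamilyPrincipalCapBetaSix
import Summits.CriticalPhenomena.PercolationContinuityZ3.Theorems.SahiMasterFamilyUpperMaster
import Summits.CriticalPhenomena.PercolationContinuityZ3.Theorems.SahiMasterFamilyUpperMasterSixCert1
import Summits.CriticalPhenomena.PercolationContinuityZ3.Theorems.SahiMasterFamilyUpperMasterSixCert2
import Summits.CriticalPhenomena.PercolationContinuityZ3.Theorems.SahiMasterFamilyUpperMasterSixCert3
import Summits.CriticalPhenomena.PercolationContinuityZ3.Theorems.SahiMasterFamilyUpperMasterSixCert4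
import Summits.CriticalPhenomena.PercolationContinuityZ3.Theorems.SahiMasterFamilyUpperMasterSixCert5
import Summits.CriticalPhenomena.PercolationContinuityZ3.Theorems.SahiMasterFamilyUpperMasterSixCert6
import Summits.CriticalPhenomena.PercolationContinuityZ3.Theorems.SahiMasterFamilyUpperMasterSixCert7
import Summits.CriticalPhenomena.PercolationContinuityZ3.Theorems.SahiMasterFamilyUpperMasterSixCert8
import Summits.CriticalPhenomena.PercolationContinuityZ3.Theorems.SahiMasterFamilyUpperMasterSixCert9
import Summits.CriticalPhenomena.PercolationContinuityZ3.Theorems.SahiMasterFamilyUpperMasterSixCert10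
import Summits.CriticalPhenomena.PercolationContinuityZ3.Theorems.SahiMasterFamilyUpperMasterSixCert11

/-!
# The upper master inequality at order 6: `Φ_6(β) ≤ 120·(β_⊤ − ∏_i β_i)` for supermultiplicative set functions, and
# `E_6(1_{A_0},…) ≤ 120·(μ(⋂A_i) − ∏ μ(A_i))` for increasing events

Unit `prim-masterthm-p4` (gen 13; crux anchor stmt-CriticalPhenomena-4575, helper work; memo P4-GEN13-REPORT.md §6/§9).  Companion of `…UpperMaster` (orders 3, 4).
CERTIFICATE (kit j124697, symmetry-reduced LP, verified exactly): a non-negative combination of "merge gaps" `(β_{c∪c'} − β_c β_{c'})·∏_{other blocks} β_B`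
(= `w(merged) − w(split)` for the cycle weights of Sahi's functional), chunks `…UpperMasterSixCert*`.  Event form (increasing events, via `PrincipalCapBeta.sahiE_eq_phiSet` + Harris): `…UpperMasterEvents`.
Conjecture U(n) for all n: `UpperMaster.PhiLeTopGap` (typed in `…UpperMaster`); the uniform 'merge-matching' scheme provably stops at n = 8 (c(8,3) > c(8,2)).
HONEST FRAMING: an UPPER bound; Sahi's lower bound `C_6` remains OPEN in general.  Axioms standard. [this work]
-/

noncomputable section

open scoped Classical

namespace Summit.CriticalPhenomena.PercolationContinuityZ3.Theorems

namespace UpperMaster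

open Finset Function
open Literature.Combinatorics.Sahi2008
open Literature.Probability.Percolation.DecisionTree (ind)

set_option maxRecDepth 200000 in
set_option maxHeartbeats 8000000 in
/-- **Abstract `U(6)`**: `Φ_6(β) ≤ 120(β_⊤ − ∏β_i)` for every non-negative supermultiplicative set function on `Finset (Fin 6)`. [this work] -/
theorem phiSet_six_le_top_gap (β : Finset (Fin 6) → ℝ) (h0 : ∀ B, 0 ≤ β B) (hsup : ∀ S T, β S * β T ≤ β (S ∪ T)) :
    PrincipalCapBeta.phiSet 6 β ≤ 120 * (β univ - β {0} * β {1} * β {2} * β {3} * β {4} * β {5}) := by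
  have hsum := (add_nonneg (u6piece1_nonneg β h0 hsup) (add_nonneg (u6piece2_nonneg β h0 hsup) (add_nonneg (u6piece3_nonneg β h0 hsup) (add_nonneg (u6piece4_nonneg β h0 hsup) (add_nonneg (u6piece5_nonneg β h0 hsup) (add_nonneg (u6piece6_nonneg β h0 hsup) (add_nonneg (u6piece7_nonneg β h0 hsup) (add_nonneg (u6piece8_nonneg β h0 hsup) (add_nonneg (u6piece9_nonneg β h0 hsup) (add_nonneg (u6piece10_nonneg β h0 hsup) (u6piece11_nonneg β h0 hsup)))))))))))
  rw [u6piece1_eq β, u6piece2_eq β, u6piece3_eq β, u6piece4_eq β, u6piece5_eq β, u6piece6_eq β, u6piece7_eq β, u6piece8_eq β, u6piece9_eq β, u6piece10_eq β, u6piece11_eq β] at hsum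
  rw [PrincipalCapBeta.phiSet_six]
  linarith [hsum]

/-- **`U(6)` in the typed form** `PhiLeTopGap 6`. [this work] -/
theorem phiLeTopGap_six : PhiLeTopGap 6 := by
  intro β h0 hsup
  have h := phiSet_six_le_top_gap β h0 hsup
  have e : ∏ i : Fin 6, β {i} = β {0} * β {1} * β {2} * β {3} * β {4} * β {5} := by
    rw [Fin.prod_univ_six]
  rw [e]; norm_num [Nat.factorial]; linarith

end UpperMaster

end Summit.CriticalPhenomena.PercolationContinuityZ3.Theorems
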